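import Summits.ResolutionOfSingularities.ResolutionOfSingularities.Theorems.HomologicalConductorNoZenoSplitFieldCount
import Summits.ResolutionOfSingularities.ResolutionOfSingularities.Theorems.HomologicalConductorNoZenoSplitFieldSepClosed
import Summits.ResolutionOfSingularities.ResolutionOfSingularities.Theorems.HomologicalConductorNoZenoSepClosedMinpoly
import HarnessLib

/-!
# Crux `NoZenoR` / `NoZeno` (stmt-ResolutionOfSingularities-19943 / -16483), β2 descent, `stub_L1wCore` (F1) route,
# BC-2 algebra (assembly, I): the fibre `Spec (K' ⊗_κ F)` — its points are the `𝔪·(K' ⊗_κ F)`, `𝔪 ∈ MaxSpec (K' ⊗_κ L)`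

OURS (cell res-hironaka, chain W4.4; stub worker res-L0-w44-stub-2 g12; brick DAG `L1W-PREP-v2.md` 95253e48ec58b05c
§2.1 D3/D5, brick BC-2).  Pure commutative algebra over Mathlib, assembling BC-2b (i) `…SepClosedMinpoly`, (ii)
`…SplitFieldCount`, (iii) `…SplitFieldSepClosed`; nothing here is a statement of the manuscript under review
(Hironaka 2017); AI-written, weaker than expert review.

Setting: `κ` (residue field of the germ), `K'/κ` finite separable (residue field `κ_B` of the splitting base),
`F/κ` any field extension (the function field `κ(η)` of an integral exceptional curve), and a finite separable `L/κ`
inside `F` which is separably closed in `F` (`separableClosure L F = ⊥`) — necessarily `L = κ^s ∩ F`, the separable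
constant field, taken abstract to keep the statements coercion-free; the last section specialises to
`L := separableClosure κ F`.  The fibre of the base change over `η` is `Spec A`, `A := K' ⊗_κ F`
(file `…PullbackResidueField`), and the split weight of a point `p` of the fibre is `[κ(p)^s : K']`, `κ(p)^s` the
separable closure of `K'` in the residue field `κ(p)` (`K'` acting through the left factor).

Structure of `A` through `M := K' ⊗_κ L = ∏_j M_j` (reduced Artinian, BC-2b (ii)) and the base change
`φ = id ⊗ (L ⊆ F) : M → A` of the inclusion:
* `map_ne_top` — `𝔪A ≠ A` (a `κ`-algebra map `A → Ω` to an algebraic closure of `F` extending an `L`-embedding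
  `M/𝔪 → Ω` kills `𝔪A`);
* **`isField_quotient_map`**, `isMaximal_map` — `A/𝔪A` is a FIELD: it is the image of the field `F[X]/(q_F)`, `q`
  the minimal polynomial of a primitive element of `M_j/L`, `q_F` its image over `F`, still irreducible because `L`
  is separably closed in `F` (BC-2b (i));
* `comap_map`, `exists_eq_map_comap`, **`map_bijective`** — `𝔪 ↦ 𝔪A` is a bijection `MaxSpec M ≃ Spec A`;
  `isMaximal_of_isPrime`, `finite_primeSpectrum`;
* the weights `[(A/𝔪A)^s : K'] = [M_j : K']` and the sum `Σ_{p ∈ Spec A} [κ(p)^s : K'] = [L : κ]` are in the sequel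
  `…NoZenoSplitFieldFibreCount`.
-/

noncomputable section

-- single-problem summit: the doubled namespace component `ResolutionOfSingularities` is forced
set_option linter.dupNamespace false

namespace Summit.ResolutionOfSingularities.ResolutionOfSingularities.Theorems.NoZeno.ExcCount

open TensorProduct Polynomial IntermediateField

namespace SplitFieldFibre

-- Inside proofs, `F` acts on `K' ⊗[κ] F` and `L` on `K' ⊗[κ] L` through the RIGHT factor
-- (Mathlib's non-instance `Algebra.TensorProduct.rightAlgebra`, introduced with `letI`).

variable (κ K' F L : Type*) [Field κ] [Field K'] [Field F] [Field L] [Algebra κ K'] [Algebra κ F] [Algebra κ L]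
  [Algebra L F] [IsScalarTower κ L F]

/-! ## The base change `φ = id ⊗ (L → F) : K' ⊗_κ L → K' ⊗_κ F` of the structure map -/

/-- `φ (k ⊗ ℓ) = k ⊗ ℓ`. [folklore] -/
theorem phi_tmul (k : K') (ℓ : L) : (Algebra.TensorProduct.map (AlgHom.id K' K') (IsScalarTower.toAlgHom κ L F)) (k ⊗ₜ[κ] ℓ) = k ⊗ₜ[κ] algebraMap L F ℓ := by
  rw [Algebra.TensorProduct.map_tmul]
  rfl

/-- `φ` on the right structures (`rightAlgebra`): `φ (algebraMap L _ ℓ) = algebraMap F _ (algebraMap L F ℓ)`.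
[folklore] -/
theorem phi_algebraMap (ℓ : L) :
    letI : Algebra L (K' ⊗[κ] L) := Algebra.TensorProduct.rightAlgebra
    letI : Algebra F (K' ⊗[κ] F) := Algebra.TensorProduct.rightAlgebra
    (Algebra.TensorProduct.map (AlgHom.id K' K') (IsScalarTower.toAlgHom κ L F)) (algebraMap L (K' ⊗[κ] L) ℓ) = algebraMap F (K' ⊗[κ] F) (algebraMap L F ℓ) := by
  change (Algebra.TensorProduct.map (AlgHom.id K' K') (IsScalarTower.toAlgHom κ L F)) ((1 : K') ⊗ₜ[κ] ℓ) = (1 : K') ⊗ₜ[κ] (algebraMap L F ℓ)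
  rw [phi_tmul]

/-- `φ` on the left structures: `φ (k ⊗ 1) = k ⊗ 1`. [folklore] -/
theorem phi_algebraMap_left (k : K') :
    (Algebra.TensorProduct.map (AlgHom.id K' K') (IsScalarTower.toAlgHom κ L F)) (algebraMap K' (K' ⊗[κ] L) k) = algebraMap K' (K' ⊗[κ] F) k := by
  rw [AlgHom.commutes]

/-- A pure tensor is the product of its two legs (`rightAlgebra` for the second). [folklore] -/
theorem tmul_eq_algebraMap_mul (B : Type*) [Field B] [Algebra κ B] (k : K') (x : B) :
    letI : Algebra B (K' ⊗[κ] B) := Algebra.TensorProduct.rightAlgebra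
    (k ⊗ₜ[κ] x : K' ⊗[κ] B) = algebraMap K' (K' ⊗[κ] B) k * algebraMap B (K' ⊗[κ] B) x := by
  change _ = (k ⊗ₜ[κ] (1 : B)) * ((1 : K') ⊗ₜ[κ] x)
  rw [Algebra.TensorProduct.tmul_mul_tmul, mul_one, one_mul]

/-! ## `M = K' ⊗_κ L` and its residue fields `M_j = M/𝔪` -/

/-- `M/𝔪` is separable over `κ`: `M` is formally unramified over `κ` (`K'`, `L` separable), hence so is its field
quotient `M/𝔪`, which is finite over `κ`. [this work] -/
theorem isSeparable_quotient [Algebra.IsSeparable κ K'] [FiniteDimensional κ K'] [FiniteDimensional κ L]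
    [Algebra.IsSeparable κ L] (𝔪 : Ideal (K' ⊗[κ] L)) [𝔪.IsMaximal] :
    letI := Ideal.Quotient.field 𝔪
    Algebra.IsSeparable κ ((K' ⊗[κ] L) ⧸ 𝔪) := by
  letI := Ideal.Quotient.field 𝔪
  haveI : Algebra.FormallyUnramified κ K' := Algebra.FormallyUnramified.of_isSeparable κ K'
  haveI : Algebra.FormallyUnramified κ L := Algebra.FormallyUnramified.of_isSeparable κ L
  haveI : Algebra.FormallyUnramified K' (K' ⊗[κ] L) := inferInstance
  haveI : Algebra.FormallyUnramified κ (K' ⊗[κ] L) := Algebra.FormallyUnramified.comp κ K' (K' ⊗[κ] L)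
  haveI : Algebra.FormallyUnramified κ ((K' ⊗[κ] L) ⧸ 𝔪) := inferInstance
  haveI : Module.Finite κ ((K' ⊗[κ] L) ⧸ 𝔪) := inferInstance
  haveI : Algebra.EssFiniteType κ ((K' ⊗[κ] L) ⧸ 𝔪) := inferInstance
  exact Algebra.FormallyUnramified.isSeparable κ _

/-! ## `𝔪A ≠ A`: a character of `A = K' ⊗_κ F` extending an `L`-embedding of `M/𝔪` -/

/-- **`𝔪·(K' ⊗_κ F) ≠ ⊤`** for every maximal ideal `𝔪` of `K' ⊗_κ L`. Proof: choose an `L`-embedding `χ` of the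
field `M/𝔪` (finite over `L`) into an algebraic closure `Ω` of `F`; the `κ`-algebra map `K' ⊗_κ F → Ω`,
`k ⊗ x ↦ χ(k ⊗ 1)·x`, restricts to `χ ∘ (M → M/𝔪)` on `M`, so it kills `𝔪`, and `𝔪A` lies in its (proper) kernel.
[this work] -/
theorem map_ne_top [FiniteDimensional κ K'] [FiniteDimensional κ L] (𝔪 : Ideal (K' ⊗[κ] L)) [𝔪.IsMaximal] :
    𝔪.map (Algebra.TensorProduct.map (AlgHom.id K' K') (IsScalarTower.toAlgHom κ L F)) ≠ ⊤ := by
  letI := Ideal.Quotient.field 𝔪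
  letI : Algebra L (K' ⊗[κ] L) := Algebra.TensorProduct.rightAlgebra
  letI : Algebra F (K' ⊗[κ] F) := Algebra.TensorProduct.rightAlgebra
  haveI : Module.Finite κ ((K' ⊗[κ] L) ⧸ 𝔪) := inferInstance
  haveI : Module.Finite L ((K' ⊗[κ] L) ⧸ 𝔪) := Module.Finite.of_restrictScalars_finite κ L _
  haveI : Algebra.IsAlgebraic L ((K' ⊗[κ] L) ⧸ 𝔪) := Algebra.IsAlgebraic.of_finite L _
  let χ : ((K' ⊗[κ] L) ⧸ 𝔪) →ₐ[L] AlgebraicClosure F := IsAlgClosed.lift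
  -- the two legs `K' → Ω`, `F → Ω` of the character
  let χK : K' →ₐ[κ] AlgebraicClosure F :=
    (χ.restrictScalars κ).comp ((Ideal.Quotient.mkₐ κ 𝔪).comp
      (Algebra.TensorProduct.includeLeft : K' →ₐ[κ] K' ⊗[κ] L))
  let χF : F →ₐ[κ] AlgebraicClosure F := IsScalarTower.toAlgHom κ F (AlgebraicClosure F)
  let Ψ : K' ⊗[κ] F →ₐ[κ] AlgebraicClosure F := Algebra.TensorProduct.lift χK χF fun _ _ => Commute.all _ _
  -- `Ψ ∘ φ = χ ∘ mk` on `M = K' ⊗_κ L`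
  have hcomp : Ψ.comp ((Algebra.TensorProduct.map (AlgHom.id K' K') (IsScalarTower.toAlgHom κ L F)).restrictScalars κ) = (χ.restrictScalars κ).comp (Ideal.Quotient.mkₐ κ 𝔪) := by
    apply Algebra.TensorProduct.ext'
    intro k ℓ
    change Ψ ((Algebra.TensorProduct.map (AlgHom.id K' K') (IsScalarTower.toAlgHom κ L F)) (k ⊗ₜ[κ] ℓ)) = χ (Ideal.Quotient.mk 𝔪 (k ⊗ₜ[κ] ℓ))
    rw [phi_tmul, Algebra.TensorProduct.lift_tmul, tmul_eq_algebraMap_mul κ K' L, map_mul, map_mul,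
      ← Ideal.Quotient.algebraMap_eq, ← IsScalarTower.algebraMap_apply L, AlgHom.commutes,
      IsScalarTower.algebraMap_apply L F (AlgebraicClosure F)]
    rfl
  intro htop
  have hker : 𝔪.map (Algebra.TensorProduct.map (AlgHom.id K' K') (IsScalarTower.toAlgHom κ L F)) ≤ RingHom.ker Ψ.toRingHom := by
    rw [Ideal.map_le_iff_le_comap]
    intro m hm
    change Ψ ((Algebra.TensorProduct.map (AlgHom.id K' K') (IsScalarTower.toAlgHom κ L F)) m) = 0
    have h := congrArg (fun ψ => ψ m) hcomp
    change Ψ ((Algebra.TensorProduct.map (AlgHom.id K' K') (IsScalarTower.toAlgHom κ L F)) m) = χ (Ideal.Quotient.mk 𝔪 m) at h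
    rw [h, Ideal.Quotient.eq_zero_iff_mem.mpr hm, map_zero]
  have h1 : (1 : K' ⊗[κ] F) ∈ 𝔪.map (Algebra.TensorProduct.map (AlgHom.id K' K') (IsScalarTower.toAlgHom κ L F)) := by rw [htop]; exact Submodule.mem_top
  have h0 : Ψ 1 = 0 := hker h1
  rw [map_one] at h0
  exact one_ne_zero h0

/-! ## `A/𝔪A` is a field: the image of `F[X]/(q_F)` -/

section Field

variable [Algebra.IsSeparable κ K'] [FiniteDimensional κ K'] [FiniteDimensional κ L] [Algebra.IsSeparable κ L]
  (h0 : separableClosure L F = ⊥) (𝔪 : Ideal (K' ⊗[κ] L)) [𝔪.IsMaximal]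

include h0 in
/-- **`A/𝔪A` is the homomorphic image of the field `F[X]/(q_F)`**, `q` the minimal polynomial over `L` of a primitive
element `β` of `M/𝔪` (finite separable over `L`), `q_F` its image over `F` — irreducible because `L` is separably
closed in `F` (BC-2b (i)) — under `X ↦ φ(β̃) mod 𝔪A` for a lift `β̃ ∈ M` of `β`: the image contains `F` and, since
`M/𝔪 = L[β]`, the classes of all `k ⊗ 1`. As `𝔪A ≠ ⊤`, `A/𝔪A ≅ F[X]/(q_F)` is a field. [this work] -/
theorem isField_quotient_map : IsField ((K' ⊗[κ] F) ⧸ 𝔪.map (Algebra.TensorProduct.map (AlgHom.id K' K') (IsScalarTower.toAlgHom κ L F))) := by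
  letI := Ideal.Quotient.field 𝔪
  letI : Algebra L (K' ⊗[κ] L) := Algebra.TensorProduct.rightAlgebra
  letI : Algebra F (K' ⊗[κ] F) := Algebra.TensorProduct.rightAlgebra
  set P : Ideal (K' ⊗[κ] F) := 𝔪.map (Algebra.TensorProduct.map (AlgHom.id K' K') (IsScalarTower.toAlgHom κ L F)) with hP
  haveI : Module.Finite κ ((K' ⊗[κ] L) ⧸ 𝔪) := inferInstance
  haveI : Module.Finite L ((K' ⊗[κ] L) ⧸ 𝔪) := Module.Finite.of_restrictScalars_finite κ L _
  haveI : Algebra.IsSeparable κ ((K' ⊗[κ] L) ⧸ 𝔪) := isSeparable_quotient κ K' L 𝔪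
  haveI : Algebra.IsSeparable L ((K' ⊗[κ] L) ⧸ 𝔪) := Algebra.isSeparable_tower_top_of_isSeparable κ L _
  -- a primitive element `β` of `(M/𝔪)/L`, its minimal polynomial `q`, a lift `β̃ ∈ M`
  obtain ⟨β, hβ⟩ := Field.exists_primitive_element L ((K' ⊗[κ] L) ⧸ 𝔪)
  have hβint : IsIntegral L β := (Algebra.IsSeparable.isSeparable L β).isIntegral
  set q : L[X] := minpoly L β with hq
  have hqirr : Irreducible q := minpoly.irreducible hβint
  have hqsep : q.Separable := Algebra.IsSeparable.isSeparable L β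
  obtain ⟨βt, hβt⟩ := Ideal.Quotient.mk_surjective (I := 𝔪) β
  -- `q_F` is irreducible over `F`: `L` is separably closed in `F`
  set qF : F[X] := q.map (algebraMap L F) with hqF
  have hqFirr : Irreducible qF := hqsep.map_irreducible_of_separableClosure_eq_bot h0 hqirr
  haveI : Fact (Irreducible qF) := ⟨hqFirr⟩
  -- the map `Ψ : F[X]/(q_F) → A/P`, `X ↦ φ β̃ mod P`
  let i : F →+* (K' ⊗[κ] F) ⧸ P := (Ideal.Quotient.mk P).comp (algebraMap F (K' ⊗[κ] F))
  let ψ : (K' ⊗[κ] L) →+* (K' ⊗[κ] F) ⧸ P := (Ideal.Quotient.mk P).comp (Algebra.TensorProduct.map (AlgHom.id K' K') (IsScalarTower.toAlgHom κ L F)).toRingHom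
  set b : (K' ⊗[κ] F) ⧸ P := ψ βt with hb
  have hψL : i.comp (algebraMap L F) = ψ.comp (algebraMap L (K' ⊗[κ] L)) := by
    ext ℓ
    change Ideal.Quotient.mk P (algebraMap F (K' ⊗[κ] F) (algebraMap L F ℓ)) =
      Ideal.Quotient.mk P ((Algebra.TensorProduct.map (AlgHom.id K' K') (IsScalarTower.toAlgHom κ L F)) (algebraMap L (K' ⊗[κ] L) ℓ))
    rw [phi_algebraMap]
  have hψ𝔪 : ∀ m ∈ 𝔪, ψ m = 0 := fun m hm =>
    Ideal.Quotient.eq_zero_iff_mem.mpr (Ideal.mem_map_of_mem _ hm)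
  -- `aeval` along `M → M/𝔪`: `mk (aeval β̃ r) = aeval β r`
  have haevalM : ∀ r : L[X], Ideal.Quotient.mk 𝔪 (aeval βt r) = aeval β r := by
    intro r
    rw [← hβt, ← Ideal.Quotient.mkₐ_eq_mk L, ← Polynomial.aeval_algHom_apply]
  -- `ψ (aeval β̃ r) = (r.map (L → F)).eval₂ i b`
  have haevalψ : ∀ r : L[X], ψ (aeval βt r) = (r.map (algebraMap L F)).eval₂ i b := by
    intro r
    rw [Polynomial.eval₂_map, hψL, Polynomial.aeval_def, Polynomial.hom_eval₂]
  have hqb : qF.eval₂ i b = 0 := by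
    rw [hqF, ← haevalψ]
    have hmem : aeval βt q ∈ 𝔪 := by
      rw [← Ideal.Quotient.eq_zero_iff_mem, haevalM, hq, minpoly.aeval]
    exact hψ𝔪 _ hmem
  let Ψ : AdjoinRoot qF →+* (K' ⊗[κ] F) ⧸ P := AdjoinRoot.lift i b hqb
  -- `Ψ` is onto: its range contains the classes of `k ⊗ 1` (as `M/𝔪 = L[β]`) and of `1 ⊗ x`
  have hΨK : ∀ k : K', Ideal.Quotient.mk P (algebraMap K' (K' ⊗[κ] F) k) ∈ Ψ.range := by
    intro k
    have hmem : Ideal.Quotient.mk 𝔪 (algebraMap K' (K' ⊗[κ] L) k) ∈ (L⟮β⟯).toSubalgebra := by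
      rw [hβ]; trivial
    rw [IntermediateField.adjoin_simple_toSubalgebra_of_isAlgebraic hβint.isAlgebraic,
      Algebra.adjoin_singleton_eq_range_aeval] at hmem
    obtain ⟨r, hr⟩ := hmem
    change aeval β r = _ at hr
    have hdiff : algebraMap K' (K' ⊗[κ] L) k - aeval βt r ∈ 𝔪 := by
      rw [← Ideal.Quotient.eq_zero_iff_mem, map_sub, haevalM, hr, sub_self]
    have hψk : ψ (algebraMap K' (K' ⊗[κ] L) k) = ψ (aeval βt r) := by
      rw [← sub_eq_zero, ← map_sub]
      exact hψ𝔪 _ hdiff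
    refine ⟨AdjoinRoot.mk qF (r.map (algebraMap L F)), ?_⟩
    rw [AdjoinRoot.lift_mk, ← haevalψ, ← hψk]
    change Ideal.Quotient.mk P ((Algebra.TensorProduct.map (AlgHom.id K' K') (IsScalarTower.toAlgHom κ L F)) (algebraMap K' (K' ⊗[κ] L) k)) = _
    rw [phi_algebraMap_left]
  have hΨF : ∀ x : F, Ideal.Quotient.mk P (algebraMap F (K' ⊗[κ] F) x) ∈ Ψ.range :=
    fun x => ⟨AdjoinRoot.of qF x, AdjoinRoot.lift_of hqb⟩
  have hΨsurj : Function.Surjective Ψ := by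
    rw [← RingHom.range_eq_top, eq_top_iff]
    rintro y -
    obtain ⟨a, rfl⟩ := Ideal.Quotient.mk_surjective y
    induction a using TensorProduct.induction_on with
    | zero => rw [map_zero]; exact Subring.zero_mem _
    | tmul k x =>
      rw [tmul_eq_algebraMap_mul κ K' F, map_mul]
      exact Subring.mul_mem _ (hΨK k) (hΨF x)
    | add a a' ha ha' => rw [map_add]; exact Subring.add_mem _ ha ha'
  -- `A/P` is nontrivial, so `Ψ` is injective (its source is a field), and `A/P ≅ F[X]/(q_F)` is a field
  haveI : Nontrivial ((K' ⊗[κ] F) ⧸ P) := Ideal.Quotient.nontrivial_iff.mpr (map_ne_top κ K' F L 𝔪)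
  let e : AdjoinRoot qF ≃+* (K' ⊗[κ] F) ⧸ P := RingEquiv.ofBijective Ψ ⟨Ψ.injective, hΨsurj⟩
  exact e.symm.toMulEquiv.isField (Field.toIsField (AdjoinRoot qF))

include h0 in
/-- **`𝔪A` is a maximal ideal of `A = K' ⊗_κ F`.** [this work] -/
theorem isMaximal_map : (𝔪.map (Algebra.TensorProduct.map (AlgHom.id K' K') (IsScalarTower.toAlgHom κ L F))).IsMaximal :=
  Ideal.Quotient.maximal_of_isField _ (isField_quotient_map κ K' F L h0 𝔪)

include h0 in
/-- `𝔪A ∩ M = 𝔪`. [this work] -/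
theorem comap_map : (𝔪.map (Algebra.TensorProduct.map (AlgHom.id K' K') (IsScalarTower.toAlgHom κ L F))).comap (Algebra.TensorProduct.map (AlgHom.id K' K') (IsScalarTower.toAlgHom κ L F)) = 𝔪 :=
  (Ideal.IsMaximal.eq_of_le inferInstance
    (Ideal.comap_ne_top _ (isMaximal_map κ K' F L h0 𝔪).ne_top) Ideal.le_comap_map).symm

end Field

/-! ## `MaxSpec M ≃ Spec A`, `𝔪 ↦ 𝔪A` -/

section Spectrum

variable [Algebra.IsSeparable κ K'] [FiniteDimensional κ K'] [FiniteDimensional κ L] [Algebra.IsSeparable κ L]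
  (h0 : separableClosure L F = ⊥)

include h0 in
/-- Every prime `p` of `A = K' ⊗_κ F` is `𝔪A` for the maximal ideal `𝔪 := p ∩ M` of the Artinian ring `M`
(`𝔪A ⊆ p` and `𝔪A` is maximal). [this work] -/
theorem exists_eq_map_comap (p : Ideal (K' ⊗[κ] F)) [hp : p.IsPrime] :
    ∃ 𝔪 : MaximalSpectrum (K' ⊗[κ] L), 𝔪.asIdeal = p.comap (Algebra.TensorProduct.map (AlgHom.id K' K') (IsScalarTower.toAlgHom κ L F)) ∧ p = 𝔪.asIdeal.map (Algebra.TensorProduct.map (AlgHom.id K' K') (IsScalarTower.toAlgHom κ L F)) := by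
  haveI : IsArtinianRing (K' ⊗[κ] L) := isArtinianRing_tensorProduct κ L K'
  haveI : (p.comap (Algebra.TensorProduct.map (AlgHom.id K' K') (IsScalarTower.toAlgHom κ L F))).IsPrime := Ideal.comap_isPrime _ p
  haveI hmax : (p.comap (Algebra.TensorProduct.map (AlgHom.id K' K') (IsScalarTower.toAlgHom κ L F))).IsMaximal := IsArtinianRing.isMaximal_of_isPrime _
  refine ⟨⟨p.comap (Algebra.TensorProduct.map (AlgHom.id K' K') (IsScalarTower.toAlgHom κ L F)), hmax⟩, rfl, ?_⟩
  exact ((isMaximal_map κ K' F L h0 (p.comap (Algebra.TensorProduct.map (AlgHom.id K' K') (IsScalarTower.toAlgHom κ L F)))).eq_of_le hp.ne_top Ideal.map_comap_le).symm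

include h0 in
/-- **Every prime of `K' ⊗_κ F` is maximal.** [this work] -/
theorem isMaximal_of_isPrime (p : Ideal (K' ⊗[κ] F)) [p.IsPrime] : p.IsMaximal := by
  obtain ⟨𝔪, -, hp⟩ := exists_eq_map_comap κ K' F L h0 p
  rw [hp]
  haveI := 𝔪.isMaximal
  exact isMaximal_map κ K' F L h0 𝔪.asIdeal

include h0 in
/-- **`𝔪 ↦ 𝔪A` is a bijection `MaxSpec (K' ⊗_κ L) ≃ Spec (K' ⊗_κ F)`.** [this work] -/
theorem map_bijective :
    Function.Bijective fun 𝔪 : MaximalSpectrum (K' ⊗[κ] L) =>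
      (⟨𝔪.asIdeal.map (Algebra.TensorProduct.map (AlgHom.id K' K') (IsScalarTower.toAlgHom κ L F)), (haveI := 𝔪.isMaximal; isMaximal_map κ K' F L h0 𝔪.asIdeal).isPrime⟩ :
        PrimeSpectrum (K' ⊗[κ] F)) := by
  constructor
  · intro 𝔪 𝔪' h
    have h' := congrArg (fun p : PrimeSpectrum (K' ⊗[κ] F) => p.asIdeal.comap (Algebra.TensorProduct.map (AlgHom.id K' K') (IsScalarTower.toAlgHom κ L F))) h
    haveI := 𝔪.isMaximal
    haveI := 𝔪'.isMaximal
    simp only [comap_map κ K' F L h0] at h'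
    exact MaximalSpectrum.ext h'
  · intro p
    obtain ⟨𝔪, -, hp⟩ := exists_eq_map_comap κ K' F L h0 p.asIdeal
    exact ⟨𝔪, PrimeSpectrum.ext hp.symm⟩

include h0 in
/-- `Spec (K' ⊗_κ F)` is finite. [this work] -/
theorem finite_primeSpectrum : Finite (PrimeSpectrum (K' ⊗[κ] F)) := by
  haveI : IsArtinianRing (K' ⊗[κ] L) := isArtinianRing_tensorProduct κ L K'
  haveI : Finite (MaximalSpectrum (K' ⊗[κ] L)) := inferInstance
  exact Finite.of_surjective _ (map_bijective κ K' F L h0).2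

end Spectrum

end SplitFieldFibre

end Summit.ResolutionOfSingularities.ResolutionOfSingularities.Theorems.NoZeno.ExcCount

end
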